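import Summits.ResolutionOfSingularities.ResolutionOfSingularities.Theorems.FrobeniusClosingPatchingRelPerfectDepthOneTargetsDefs
import Summits.ResolutionOfSingularities.ResolutionOfSingularities.Theorems.FrobeniusClosingPatchingRelPerfectDepthOneDivisorialFactorization

/-!
# Chain W5.2 — r-d1 target S-A2 `DepthOneTargets.DivisorialFactorization` HOLDS, BY NAME

[OURS · L1 W5.2] One-line closure of plan-1's typed target S-A2 (`ChainW52TargetsE.lean` 9d67ec503d849faa,
now the tree module `…FrobeniusClosingPatchingRelPerfectDepthOneTargetsDefs.lean`, p496180) by the content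
proof `DepthOne.divisorialFactorization` (`…FrobeniusClosingPatchingRelPerfectDepthOneDivisorialFactorization.lean`,
p495358; identical binder shape, conclusion `IsRegularDivisorial 𝔟` unfolded there): a non-zero locally
principal ideal sheaf on a regular integral Noetherian scheme whose support lies in a finite union of closed
sets `D` with `𝓘(D)` effective Cartier and `V(𝓘(D))` regular is a finite product of effective Cartier ideal
sheaves with regular closed subscheme. Filed by the r-d1 assembler (res-D-pv-059 as res-L1-w52-lead-2); crux
`PatchingRelPerfect`, item stmt-ResolutionOfSingularities-16161, `--as helper`. NOT a statement of the
manuscript under review; nothing of it is used.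

## References
* V. Cossart, O. Piltant, J. Algebra 320 (2008), proof of Prop. 4.2. [CossartPiltant2008]
* The Stacks Project, Tag 0357. [StacksProject]
-/

noncomputable section

open CategoryTheory AlgebraicGeometry
open Literature.AlgebraicGeometry.Resolution

set_option linter.dupNamespace false

namespace Summit.ResolutionOfSingularities.ResolutionOfSingularities.Theorems.DepthOneTargets

universe u

/-- **S-A2 `DivisorialFactorization` HOLDS** (by name): plan-1's typed target, closed by
`DepthOne.divisorialFactorization` (p495358) — same binders, same conclusion (`IsRegularDivisorial 𝔟`
unfolds to its `∃`-list form). [cite: CossartPiltant2008, proof of Prop. 4.2] [cite: StacksProject, Tag 0357] -/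
theorem divisorialFactorization_holds : DivisorialFactorization.{u} :=
  fun E _ _ hE 𝔟 h𝔟 hlp s hs hsupp => DepthOne.divisorialFactorization E hE 𝔟 h𝔟 hlp s hs hsupp

end Summit.ResolutionOfSingularities.ResolutionOfSingularities.Theorems.DepthOneTargets

end
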